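import Mathlib
import HarnessLib

/-!
# Viscous CLM profile MODEL at the Schochet corner: classification of the complex ODE `W″ = κ W²` on `ℝ`
# (the only solutions tending to `0` together with their derivative are `0` and the double poles `(6/κ)/(x − z₀)²`)

HONEST FRAMING (cell ns-blowup GROUP B «PROFILE SEARCH», zone Z3 = the 1-D viscous gCLM/OSW sheet; human rulings
D-0035/D-0074): **1-D MODEL; one-variable complex-valued calculus kernel-checked; not Euler, not Navier–Stokes;
«violates: none — MODEL».** Nothing in this file is a statement about Navier–Stokes.

CONTEXT. At the degenerate corner `(c_ω, c_l, a) = (0, 0, 0)` of the NS-type line of the frozen-`ε` profile sheet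
(`SheetNSLineSchochetCorner`, `HOME/profile/z3/SHEET.md` §13) the profile equation is `(HΩ)Ω + εΩ″ = 0`. Applying the
Hilbert transform (the product rule `H(Ω·HΩ) = ½((HΩ)² − Ω²)`, companion files) turns it, for the ANALYTIC SIGNAL
`W = Ω + i HΩ`, into the complex second-order ODE on the real line
  `ε W″ = (i/2) W²`,  i.e. `W″ = κ W²` with `κ = i/(2ε)`
[Schochet 1986; ALSS 2024 §5.1: «apply `ℙ₊` to CLM (`a = 0`): `ω₊,t = −iω₊² + νω₊,xx`», here `W = 2ω₊`, steady].
THIS FILE is the pure ODE step, for an arbitrary non-zero complex constant `κ`: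

* `firstIntegral_eq_zero` — if `W, W′ → 0` at `+∞` then `W′² = (2κ/3) W³` on `ℝ` (the energy `W′² − (2κ/3)W³` is constant);
* `eq_zero_of_exists_zero` — a solution with `W′² = (2κ/3)W³` that vanishes at ONE point vanishes identically (Gronwall on
  `‖W′‖ ≤ K‖W‖`, both time directions);
* `eq_doublePole_of_ne_zero` — a nowhere-vanishing solution is `W = (6/κ)/(x − z₀)²` with `z₀ ∉ ℝ`
  (`Q := (6/κ)/W` has `Q″ = 2` and `Q′² = 4Q`, so `Q = (x − z₀)²`);
* `classification` — **every `C²` solution of `W″ = κW²` on `ℝ` with `W → 0` and `W′ → 0` at `+∞` is either `≡ 0` or a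
  double pole `(6/κ)/(x − z₀)²`, `Im z₀ ≠ 0`**; `classification_corner` — the case `κ = i/(2ε)`: `W = −12iε/(x − z₀)²`;
* `doublePole_re`, `doublePole_im` — the real and imaginary parts of `−12iε/(x − z₀)²`:
  `24ε q (x − p)/((x − p)² + q²)²` and `−12ε((x − p)² − q²)/((x − p)² + q²)²` (`z₀ = p + iq`); for `p = 0`, `q = −ℓ < 0`
  the real part is Schochet's corner profile `−24εℓ x/(x² + ℓ²)²` (`SheetNSLineSchochetCorner.corner_profile_explicit`).
NOT HERE: the Hilbert-transform product rule, the derivation of the ODE from the profile equation, anything about existence,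
anything about Euler or NS. No definitions; no `def … : Prop` hypotheses; standard axioms.
bears_on: LADDER-NS N5 / zone Z3 row Z3-E12⁻ clause (i′) («the Schochet corner is the divide») → N1 linear core.
-/

noncomputable section
open Set Filter Topology

namespace Summit.NavierStokesRegularity.OSWSelfSimilar
namespace SheetNSLineCornerODE

/-! ### The first integral -/

/-- The energy `E = W′² − (2κ/3) W³` of a solution of `W″ = κ W²` has derivative `0`. [folklore] -/
theorem hasDerivAt_energy (κ : ℂ) (W dW ddW : ℝ → ℂ) (x : ℝ)
    (hW : HasDerivAt W (dW x) x) (hdW : HasDerivAt dW (ddW x) x) (hODE : ddW x = κ * W x ^ 2) :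
    HasDerivAt (fun t => dW t ^ 2 - (2 * κ / 3) * W t ^ 3) 0 x := by
  have h1 : HasDerivAt (fun t => dW t * dW t) (ddW x * dW x + dW x * ddW x) x := hdW.mul hdW
  have h2 : HasDerivAt (fun t => W t * (W t * W t))
      (dW x * (W x * W x) + W x * (dW x * W x + W x * dW x)) x := hW.mul (hW.mul hW)
  have h3 := h1.sub (h2.const_mul (2 * κ / 3))
  have e : ddW x * dW x + dW x * ddW x - 2 * κ / 3 * (dW x * (W x * W x) + W x * (dW x * W x + W x * dW x)) = 0 := by
    rw [hODE]; ring
  rw [e] at h3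
  refine h3.congr_of_eventuallyEq (Eventually.of_forall fun t => ?_)
  simp only [Pi.sub_apply]; ring

/-- **First integral.** If `W″ = κW²` on `ℝ` and `W, W′ → 0` at `+∞`, then `W′(x)² = (2κ/3)·W(x)³` for every `x`.
[folklore; Schochet 1986 / ALSS 2024 §5.1 for `κ = i/(2ν)`] -/
theorem firstIntegral_eq_zero (κ : ℂ) (W dW ddW : ℝ → ℂ)
    (hW : ∀ x, HasDerivAt W (dW x) x) (hdW : ∀ x, HasDerivAt dW (ddW x) x) (hODE : ∀ x, ddW x = κ * W x ^ 2)
    (hW0 : Tendsto W atTop (𝓝 0)) (hdW0 : Tendsto dW atTop (𝓝 0)) (x : ℝ) :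
    dW x ^ 2 = (2 * κ / 3) * W x ^ 3 := by
  set E : ℝ → ℂ := fun t => dW t ^ 2 - (2 * κ / 3) * W t ^ 3 with hE
  have hEd : ∀ t, HasDerivAt E 0 t := fun t => hasDerivAt_energy κ W dW ddW t (hW t) (hdW t) (hODE t)
  have hconst : ∀ s t, E s = E t :=
    is_const_of_deriv_eq_zero (fun t => (hEd t).differentiableAt) (fun t => (hEd t).deriv)
  have hElim : Tendsto E atTop (𝓝 0) := by
    have h := (hdW0.pow 2).sub ((hW0.pow 3).const_mul (2 * κ / 3))
    simpa [hE] using h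
  have hEx : Tendsto E atTop (𝓝 (E x)) := by
    have : E = fun _ => E x := funext fun t => hconst t x
    rw [this]; exact tendsto_const_nhds
  have h0 : E x = 0 := tendsto_nhds_unique hEx hElim
  have : dW x ^ 2 - (2 * κ / 3) * W x ^ 3 = 0 := h0
  exact sub_eq_zero.mp this

/-! ### A solution with one zero is identically zero -/

/-- One-sided Gronwall step: if `‖W′‖² = c‖W‖³`-type control `‖dW t‖ ^ 2 ≤ c * ‖W t‖ ^ 3` holds on `ℝ`, `W(a) = 0`, then
`W = 0` on `[a, b]`. [folklore] -/
theorem eqOn_zero_Icc_of_sq_le (c : ℝ) (W dW : ℝ → ℂ) (hW : ∀ x, HasDerivAt W (dW x) x)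
    (hsq : ∀ x, ‖dW x‖ ^ 2 ≤ c * ‖W x‖ ^ 3) {a b : ℝ} (ha : W a = 0) :
    ∀ x ∈ Icc a b, W x = 0 := by
  have hc : Continuous W := continuous_iff_continuousAt.mpr fun x => (hW x).continuousAt
  -- a bound `m` for `‖W‖` on `[a,b]`
  obtain ⟨m, hm⟩ := (isCompact_Icc (a := a) (b := b)).exists_bound_of_continuousOn hc.continuousOn
  set K : ℝ := max 1 (|c| * max m 0) with hK
  have hK1 : 1 ≤ K := le_max_left _ _
  have hK0 : 0 ≤ K := zero_le_one.trans hK1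
  have hbound : ∀ x ∈ Ico a b, ‖dW x‖ ≤ K * ‖W x‖ + 0 := by
    intro x hx
    have hxm : ‖W x‖ ≤ max m 0 := (hm x (Ico_subset_Icc_self hx)).trans (le_max_left _ _)
    have h1 : ‖dW x‖ ^ 2 ≤ (K * ‖W x‖) ^ 2 := by
      calc ‖dW x‖ ^ 2 ≤ c * ‖W x‖ ^ 3 := hsq x
        _ ≤ |c| * ‖W x‖ ^ 3 := by gcongr; exact le_abs_self c
        _ = (|c| * ‖W x‖) * ‖W x‖ ^ 2 := by ring
        _ ≤ (|c| * max m 0) * ‖W x‖ ^ 2 := by gcongr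
        _ ≤ K * ‖W x‖ ^ 2 := by gcongr; exact le_max_right _ _
        _ ≤ K ^ 2 * ‖W x‖ ^ 2 := by gcongr; nlinarith
        _ = (K * ‖W x‖) ^ 2 := by ring
    have h2 : ‖dW x‖ ≤ K * ‖W x‖ :=
      (pow_le_pow_iff_left₀ (norm_nonneg _) (mul_nonneg hK0 (norm_nonneg _)) two_ne_zero).mp h1
    linarith
  have hG := norm_le_gronwallBound_of_norm_deriv_right_le (f := W) (f' := dW) (δ := 0) (K := K) (ε := 0)
    (a := a) (b := b) hc.continuousOn (fun x _ => (hW x).hasDerivWithinAt) (by simp [ha]) hbound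
  intro x hx
  have h := hG x hx
  rw [gronwallBound_ε0_δ0] at h
  exact norm_le_zero_iff.mp h

/-- **A solution with one zero vanishes identically**: if `‖W′(x)‖² ≤ c‖W(x)‖³` on `ℝ` (as delivered by the first
integral `W′² = (2κ/3)W³`) and `W(x₁) = 0`, then `W ≡ 0` (Gronwall forward from `x₁`, and backward via `t ↦ W(x₁ − t)`).
[folklore] -/
theorem eq_zero_of_exists_zero (c : ℝ) (W dW : ℝ → ℂ) (hW : ∀ x, HasDerivAt W (dW x) x)
    (hsq : ∀ x, ‖dW x‖ ^ 2 ≤ c * ‖W x‖ ^ 3) {x₁ : ℝ} (hx₁ : W x₁ = 0) : W = 0 := by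
  funext x
  rcases le_or_gt x₁ x with hle | hlt
  · exact eqOn_zero_Icc_of_sq_le c W dW hW hsq hx₁ (b := x) x ⟨hle, le_rfl⟩
  · -- backward: `V t = W (x₁ - t)`
    set V : ℝ → ℂ := fun t => W (x₁ - t) with hV
    set dV : ℝ → ℂ := fun t => -dW (x₁ - t) with hdV
    have hVd : ∀ t, HasDerivAt V (dV t) t := by
      intro t
      have h := HasDerivAt.comp_const_sub x₁ t (hW (x₁ - t))
      simpa [hV, hdV] using h
    have hsqV : ∀ t, ‖dV t‖ ^ 2 ≤ c * ‖V t‖ ^ 3 := fun t => by simpa [hV, hdV, norm_neg] using hsq (x₁ - t)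
    have hV0 : V 0 = 0 := by simp [hV, hx₁]
    have h := eqOn_zero_Icc_of_sq_le c V dV hVd hsqV hV0 (b := x₁ - x) (x₁ - x) ⟨by linarith, le_rfl⟩
    simpa [hV] using h

/-! ### A nowhere-vanishing solution is a double pole -/

/-- **A nowhere-vanishing solution is a double pole.** If `W″ = κW²` (`κ ≠ 0`), `W′² = (2κ/3)W³` on `ℝ` and `W(x) ≠ 0` for
all `x`, then `W = (6/κ)/(x − z₀)²` for some `z₀ ∈ ℂ` with `Im z₀ ≠ 0`. Proof: `Q := (6/κ)/W` satisfies `Q″ = 2` and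
`Q′² = 4Q`, hence `Q = x² + βx + γ` with `β² = 4γ`, i.e. `Q = (x − z₀)²`, `z₀ = −β/2`; `z₀` is not real because `Q` has no
real zero. [folklore; the pole ansatz of Schochet 1986 / ALSS 2024 §5.1] -/
theorem eq_doublePole_of_ne_zero {κ : ℂ} (hκ : κ ≠ 0) (W dW ddW : ℝ → ℂ)
    (hW : ∀ x, HasDerivAt W (dW x) x) (hdW : ∀ x, HasDerivAt dW (ddW x) x) (hODE : ∀ x, ddW x = κ * W x ^ 2)
    (hfirst : ∀ x, dW x ^ 2 = (2 * κ / 3) * W x ^ 3) (hne : ∀ x, W x ≠ 0) :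
    ∃ z₀ : ℂ, z₀.im ≠ 0 ∧ ∀ x : ℝ, W x = (6 / κ) / ((x : ℂ) - z₀) ^ 2 := by
  obtain ⟨α, hα0, hακ, hα⟩ : ∃ α : ℂ, α ≠ 0 ∧ α * κ = 6 ∧ α = 6 / κ :=
    ⟨6 / κ, div_ne_zero (by norm_num) hκ, by field_simp, rfl⟩
  -- `Q = α / W` and its first two derivatives
  set Q : ℝ → ℂ := fun x => α / W x with hQ
  set dQ : ℝ → ℂ := fun x => -(α * dW x) / W x ^ 2 with hdQ
  have hQd : ∀ x, HasDerivAt Q (dQ x) x := by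
    intro x
    have hinv : HasDerivAt (fun z : ℂ => z⁻¹) (-((W x) ^ 2)⁻¹) (W x) := hasDerivAt_inv (hne x)
    have h := (hinv.comp x (hW x)).const_mul α
    refine h.congr_of_eventuallyEq ?_ |>.congr_deriv ?_
    · exact Eventually.of_forall fun t => by simp [hQ, div_eq_mul_inv]
    · simp [hdQ]; field_simp
  have hdQd : ∀ x, HasDerivAt dQ 2 x := by
    intro x
    have hW0 := hne x
    have hWsq : HasDerivAt (fun t => W t * W t) (dW x * W x + W x * dW x) x := (hW x).mul (hW x)
    have hinv2 : HasDerivAt (fun z : ℂ => z⁻¹) (-((W x * W x) ^ 2)⁻¹) (W x * W x) :=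
      hasDerivAt_inv (mul_ne_zero hW0 hW0)
    have h1 : HasDerivAt (fun t => (W t * W t)⁻¹) (-((W x * W x) ^ 2)⁻¹ * (dW x * W x + W x * dW x)) x :=
      hinv2.comp x hWsq
    have h2 : HasDerivAt (fun t => -(α * dW t)) (-(α * ddW x)) x := ((hdW x).const_mul α).neg
    have h3 := h2.mul h1
    have hd2 : dW x ^ 2 = (2 * κ / 3) * W x ^ 3 := hfirst x
    have e : -(α * ddW x) * (W x * W x)⁻¹ + -(α * dW x) * (-((W x * W x) ^ 2)⁻¹ * (dW x * W x + W x * dW x))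
        = 2 := by
      rw [hODE x]
      field_simp
      linear_combination (2 * α) * hd2 + (W x ^ 3 / 3) * hακ
    rw [e] at h3
    refine h3.congr_of_eventuallyEq (Eventually.of_forall fun t => ?_)
    simp only [hdQ, Pi.mul_apply, div_eq_mul_inv, pow_two]
  -- `Q′² = 4Q`
  have hsq : ∀ x, dQ x ^ 2 = 4 * Q x := by
    intro x
    have hW0 := hne x
    have hd2 : dW x ^ 2 = (2 * κ / 3) * W x ^ 3 := hfirst x
    simp only [hdQ, hQ]
    field_simp
    linear_combination α * hd2 + (2 / 3 * W x ^ 3) * hακ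
  -- `dQ = 2x + β`
  have hβ : ∀ s t, dQ s - 2 * (s : ℂ) = dQ t - 2 * (t : ℂ) := by
    have hd : ∀ t, HasDerivAt (fun t : ℝ => dQ t - 2 * (t : ℂ)) 0 t := by
      intro t
      have h2 : HasDerivAt (fun t : ℝ => 2 * (t : ℂ)) (2 * 1) t := (Complex.ofRealCLM.hasDerivAt).const_mul 2
      have h := (hdQd t).fun_sub h2
      simpa using h
    exact is_const_of_deriv_eq_zero (fun t => (hd t).differentiableAt) (fun t => (hd t).deriv)
  set β : ℂ := dQ 0 with hβdef
  have hdQ_eq : ∀ x, dQ x = 2 * (x : ℂ) + β := by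
    intro x; have h := hβ x 0; simp [hβdef] at h ⊢; linear_combination h
  -- `Q = x² + βx + γ`
  have hγ : ∀ s t, Q s - ((s : ℂ) ^ 2 + β * s) = Q t - ((t : ℂ) ^ 2 + β * t) := by
    have hd : ∀ t, HasDerivAt (fun t : ℝ => Q t - ((t : ℂ) ^ 2 + β * t)) 0 t := by
      intro t
      have hid : HasDerivAt (fun t : ℝ => (t : ℂ)) 1 t := Complex.ofRealCLM.hasDerivAt
      have h2 : HasDerivAt (fun t : ℝ => (t : ℂ) ^ 2 + β * t) (2 * (t : ℂ) + β) t := by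
        have hp := hid.mul hid
        have hl := hid.const_mul β
        have := hp.add hl
        refine this.congr_of_eventuallyEq (Eventually.of_forall fun s => by simp; ring) |>.congr_deriv (by ring)
      have := (hQd t).sub h2
      rw [hdQ_eq t, sub_self] at this
      exact this
    exact is_const_of_deriv_eq_zero (fun t => (hd t).differentiableAt) (fun t => (hd t).deriv)
  set γ : ℂ := Q 0 with hγdef
  have hQ_eq : ∀ x, Q x = (x : ℂ) ^ 2 + β * x + γ := by
    intro x; have h := hγ x 0; simp [hγdef] at h ⊢; linear_combination h
  -- `β² = 4γ` from `Q′(0)² = 4Q(0)`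
  have hβγ : β ^ 2 = 4 * γ := by
    have h := hsq 0
    rw [hdQ_eq 0, hQ_eq 0] at h
    simpa using h
  refine ⟨-(β / 2), ?_, fun x => ?_⟩
  · -- `z₀ = −β/2` is not real: `Q(Re z₀) ≠ 0`
    intro him
    have hre : ((-(β / 2)).re : ℂ) = -(β / 2) := by
      apply Complex.ext <;> simp [him]
    have hQ0 : Q ((-(β / 2)).re) = 0 := by
      rw [hQ_eq, hre]
      linear_combination (-(1:ℂ) / 4) * hβγ
    have : Q ((-(β / 2)).re) ≠ 0 := div_ne_zero hα0 (hne _)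
    exact this hQ0
  · have hQx : Q x = ((x : ℂ) - -(β / 2)) ^ 2 := by
      rw [hQ_eq]; linear_combination (1 / 4 : ℂ) * (hβγ.symm) -- γ = β²/4
    have hQne : Q x ≠ 0 := div_ne_zero hα0 (hne x)
    have : W x = α / Q x := by
      simp only [hQ]; field_simp
    rw [this, hQx, hα]

/-! ### The classification -/

/-- **CLASSIFICATION of the decaying solutions of `W″ = κW²` on `ℝ`** (`κ ≠ 0`): if `W` is `C²` (`W′ = dW`, `W″ = ddW`),
`W″ = κW²` everywhere, and `W → 0`, `W′ → 0` as `x → +∞`, then EITHER `W ≡ 0` OR `W(x) = (6/κ)/(x − z₀)²` for a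
`z₀ ∈ ℂ ∖ ℝ`. [folklore; Schochet 1986 / ALSS 2024 §5.1 (pole dynamics of the complexified viscous CLM)] -/
theorem classification {κ : ℂ} (hκ : κ ≠ 0) (W dW ddW : ℝ → ℂ)
    (hW : ∀ x, HasDerivAt W (dW x) x) (hdW : ∀ x, HasDerivAt dW (ddW x) x) (hODE : ∀ x, ddW x = κ * W x ^ 2)
    (hW0 : Tendsto W atTop (𝓝 0)) (hdW0 : Tendsto dW atTop (𝓝 0)) :
    W = 0 ∨ ∃ z₀ : ℂ, z₀.im ≠ 0 ∧ ∀ x : ℝ, W x = (6 / κ) / ((x : ℂ) - z₀) ^ 2 := by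
  have hfirst := firstIntegral_eq_zero κ W dW ddW hW hdW hODE hW0 hdW0
  by_cases hz : ∃ x₁, W x₁ = 0
  · obtain ⟨x₁, hx₁⟩ := hz
    left
    refine eq_zero_of_exists_zero (‖2 * κ / 3‖) W dW hW (fun x => ?_) hx₁
    have h := congrArg (fun z : ℂ => ‖z‖) (hfirst x)
    simp only [norm_pow, norm_mul] at h
    exact h.le
  · right
    push Not at hz
    exact eq_doublePole_of_ne_zero hκ W dW ddW hW hdW hODE hfirst hz

/-- **The corner case `κ = i/(2ε)`** (`ε ≠ 0`): every `C²` solution of `εW″ = (i/2)W²` on `ℝ` with `W, W′ → 0` at `+∞` is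
`0` or `W(x) = −12iε/(x − z₀)²`, `Im z₀ ≠ 0`. [Schochet 1986 (`B = −12νi`); ALSS 2024 §5.1, eq. for `B(t)`] -/
theorem classification_corner {ε : ℝ} (hε : ε ≠ 0) (W dW ddW : ℝ → ℂ)
    (hW : ∀ x, HasDerivAt W (dW x) x) (hdW : ∀ x, HasDerivAt dW (ddW x) x)
    (hODE : ∀ x, (ε : ℂ) * ddW x = (Complex.I / 2) * W x ^ 2)
    (hW0 : Tendsto W atTop (𝓝 0)) (hdW0 : Tendsto dW atTop (𝓝 0)) :
    W = 0 ∨ ∃ z₀ : ℂ, z₀.im ≠ 0 ∧ ∀ x : ℝ, W x = (-12 * Complex.I * ε) / ((x : ℂ) - z₀) ^ 2 := by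
  have hε' : (ε : ℂ) ≠ 0 := Complex.ofReal_ne_zero.mpr hε
  have hκ : Complex.I / (2 * ε) ≠ 0 := div_ne_zero Complex.I_ne_zero (mul_ne_zero two_ne_zero hε')
  have hODE' : ∀ x, ddW x = Complex.I / (2 * ε) * W x ^ 2 := by
    intro x; have h := hODE x; field_simp; linear_combination (2:ℂ) * h
  rcases classification hκ W dW ddW hW hdW hODE' hW0 hdW0 with h | ⟨z₀, hz₀, hWz⟩
  · exact Or.inl h
  · refine Or.inr ⟨z₀, hz₀, fun x => ?_⟩
    rw [hWz x]
    congr 1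
    field_simp
    rw [Complex.I_sq]; ring

/-! ### Real and imaginary parts of the corner double pole -/

/-- Real part of `−12iε/(x − z₀)²` at a real point: `24 ε q (x − p)/((x − p)² + q²)²`, `z₀ = p + iq`, `q ≠ 0`.
For `p = 0`, `q = −ℓ` this is Schochet's corner profile `−24εℓx/(x²+ℓ²)²`. [folklore] -/
theorem doublePole_re (ε : ℝ) {z₀ : ℂ} (hz₀ : z₀.im ≠ 0) (x : ℝ) :
    ((-12 * Complex.I * ε) / ((x : ℂ) - z₀) ^ 2).re
      = 24 * ε * z₀.im * (x - z₀.re) / ((x - z₀.re) ^ 2 + z₀.im ^ 2) ^ 2 := by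
  have hD : (x - z₀.re) ^ 2 + z₀.im ^ 2 ≠ 0 := by positivity
  have hw : ((x : ℂ) - z₀) = ⟨x - z₀.re, -z₀.im⟩ := by apply Complex.ext <;> simp
  have hw2 : ((x : ℂ) - z₀) ^ 2 ≠ 0 := by
    apply pow_ne_zero; rw [hw]; intro h; have := congrArg Complex.im h; simp at this; exact hz₀ this
  -- write the quotient as an explicit complex number and compare
  have key : (-12 * Complex.I * ε) / ((x : ℂ) - z₀) ^ 2
      = ⟨24 * ε * z₀.im * (x - z₀.re) / ((x - z₀.re) ^ 2 + z₀.im ^ 2) ^ 2,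
         -12 * ε * ((x - z₀.re) ^ 2 - z₀.im ^ 2) / ((x - z₀.re) ^ 2 + z₀.im ^ 2) ^ 2⟩ := by
    rw [div_eq_iff hw2, hw]
    apply Complex.ext <;> simp [sq, Complex.mul_re, Complex.mul_im] <;> field_simp <;> ring
  rw [key]

/-- Imaginary part of `−12iε/(x − z₀)²` at a real point: `−12 ε ((x − p)² − q²)/((x − p)² + q²)²`, `z₀ = p + iq`, `q ≠ 0`
(for `p = 0`, `q = −ℓ`: `−12ε(x² − ℓ²)/(x² + ℓ²)²`, the Hilbert transform of Schochet's profile). [folklore] -/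
theorem doublePole_im (ε : ℝ) {z₀ : ℂ} (hz₀ : z₀.im ≠ 0) (x : ℝ) :
    ((-12 * Complex.I * ε) / ((x : ℂ) - z₀) ^ 2).im
      = -12 * ε * ((x - z₀.re) ^ 2 - z₀.im ^ 2) / ((x - z₀.re) ^ 2 + z₀.im ^ 2) ^ 2 := by
  have hD : (x - z₀.re) ^ 2 + z₀.im ^ 2 ≠ 0 := by positivity
  have hw : ((x : ℂ) - z₀) = ⟨x - z₀.re, -z₀.im⟩ := by apply Complex.ext <;> simp
  have hw2 : ((x : ℂ) - z₀) ^ 2 ≠ 0 := by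
    apply pow_ne_zero; rw [hw]; intro h; have := congrArg Complex.im h; simp at this; exact hz₀ this
  have key : (-12 * Complex.I * ε) / ((x : ℂ) - z₀) ^ 2
      = ⟨24 * ε * z₀.im * (x - z₀.re) / ((x - z₀.re) ^ 2 + z₀.im ^ 2) ^ 2,
         -12 * ε * ((x - z₀.re) ^ 2 - z₀.im ^ 2) / ((x - z₀.re) ^ 2 + z₀.im ^ 2) ^ 2⟩ := by
    rw [div_eq_iff hw2, hw]
    apply Complex.ext <;> simp [sq, Complex.mul_re, Complex.mul_im] <;> field_simp <;> ring
  rw [key]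

end SheetNSLineCornerODE
end Summit.NavierStokesRegularity.OSWSelfSimilar
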